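import Summits.ABC.ABC.Theses.DefiniteXi
import Literature.NumberTheory.EllipticCurves.OpenImageMazurNumericsProofs
import Literature.NumberTheory.EllipticCurves.RankinSelbergEulerProductGaloisProofs
import Literature.NumberTheory.EllipticCurves.SupersingularDensitySerreFrobeniusProofs
import Literature.NumberTheory.EllipticCurves.IsogenyFrobeniusTraceProofs
import Literature.NumberTheory.EllipticCurves.RationalIsogenyDegreesProofs
import Literature.NumberTheory.EllipticCurves.IsogenyVariableChangeProofs
import Literature.NumberTheory.EllipticCurves.GlobalMinimalModelProofs
import Literature.NumberTheory.EllipticCurves.BSDSelmerCMPConverseMaximalOrderProofs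
import Literature.NumberTheory.EllipticCurves.PastenHeightBoundsLemma68Proofs
import Literature.NumberTheory.EllipticCurves.DegreeConjectureAbcMurtyProofs
import Literature.NumberTheory.DiophantineGeometry.GeneralizedFermatTwoPowerCoefficientSerreProofs
import Literature.NumberTheory.DiophantineGeometry.GeneralizedFermatTwoPowerCoefficientFreyProofs
import HarnessLib

/-!
# Stub-ideation k=2 (gen 6, FAMILY 2 — RESHAPE) for `stub_pasten163` — crux `DefiniteRTControlPrime`

Companion to `STUB-IDEAS-stub_pasten163-2.md` (gen 6).  Gen 5's algebraic core
(`Lines/StubIdeasK2g5_pasten163.lean`: middle curve M1, exact containers, DICH/COVER, GLOB, H5, C1³,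
C0³ = `CyclicDegreeDvdFrobNormCube`) is KEPT verbatim and not repeated here.  This file types ONLY the
gen-6 deltas — the COUNTING END re-targeted at the PROVED `N^ε` consumer
`Summit.ABC.ABC.Theorems.DefiniteRTControlPrime.definiteRTControlPrime_of_freyClassRadiusSubpoly`
(crux workfile `StubIdeasK2G4PastenLemma68.lean`, 0 sorries; it replaces k1's still-sorried
`definiteRTControlPrime_of_diameter`):

  C0³ ─B1→ `FreyClassRadiusTwoPrimes` ─B2→ `FreyClassRadiusSubpoly` ─(G4, proved, + `stub_takahashi`)→ crux.

B1 = algebraic transport (Néron model, cyclic factor, ISO, GR, H7); B2 = pure counting (H8 = Chebyshev prime-finder `exists_prime_not_dvd_le_log` + the landed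
`radical_natAbs_dvd_two_mul_conductorNorm_freyCurve` + `Real.log_le_rpow_div`).  Every `sorry` below is a helper body (one prover
cycle each); the composition `freyClassRadiusSubpoly_of_cube` is kernel-checked.
Crux workfiles are not importable modules, so `frobNorm`, `CyclicDegreeDvdFrobNormCube` (gen 5) and
`FreyClassRadiusSubpoly` (G4) are re-declared VERBATIM (same normal form; the G4/gen-5 theorems apply by
`Iff.rfl`-transport when the files are merged into one Theorems module).
-/

namespace Summit.ABC.ABC.Cruxes.DefiniteRTControlPrime.Sketch.Ideas2g6

open Literature.NumberTheory.EllipticCurves Literature.NumberTheory.DiophantineGeometry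
open WeierstrassCurve IsDedekindDomain NumberField

/-! ## §0 Verbatim copies (gen 5 `frobNorm`, C0³; G4 `FreyClassRadiusSubpoly`) -/

/-- `n₁₂(p) = p¹² + 1 − s₁₂(a_p, p) = #Ẽ(𝔽_{p¹²})` for a good prime `p` (gen 4/5, verbatim). -/
noncomputable def frobNorm (W : WeierstrassCurve ℚ) [W.IsGloballyMinimal] (p : ℕ) : ℤ :=
  (p : ℤ) ^ 12 + 1 - Mazur1978.frobTracePow (W.frobeniusTrace p) p 12

/-- C0³ (gen 5, verbatim): the Mazur–Kenku-free typed output of the middle-curve line. -/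
def CyclicDegreeDvdFrobNormCube : Prop :=
  ∀ (W₁ W₂ : WeierstrassCurve ℚ) [W₁.IsElliptic] [W₂.IsElliptic] [W₁.IsGloballyMinimal],
    (∀ v : HeightOneSpectrum (𝓞 ℚ), (2 : 𝓞 ℚ) ∉ v.asIdeal → W₁.IsSemistableAt v) →
    ∀ (φ : Isogeny W₁ W₂), φ.IsCyclic →
    ∀ (p₀ p₁ : ℕ) [Fact p₀.Prime] [Fact p₁.Prime], p₀ ≠ 2 → p₁ ≠ 2 → p₀ ≠ p₁ →
      W₁.HasGoodReductionAtPrime p₀ → W₁.HasGoodReductionAtPrime p₁ →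
      φ.degree ∣ 16 * ((frobNorm W₁ p₀ * frobNorm W₁ p₁).natAbs) ^ 3

/-- G4 leaf (verbatim `Summit.ABC.ABC.Theorems.DefiniteRTControlPrime`-side `FreyClassRadiusSubpoly`). -/
def FreyClassRadiusSubpoly : Prop :=
  ∀ ε : ℝ, 0 < ε → ∃ R : ℝ, ∀ (a b : ℤ), IsCoprime a b → a * b * (a + b) ≠ 0 →
    ∀ q : ℕ, q.Prime → q ≠ 2 → q ∣ (freyCurve a b).conductorNorm ℤ →
    ∀ (W₁ W₂ : WeierstrassCurve ℚ) [W₁.IsElliptic] [W₂.IsElliptic],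
      W₁.IsIsogenous (freyCurve a b) → W₂.IsIsogenous (freyCurve a b) →
        ∃ φ : Isogeny W₁ W₂,
          (φ.degree : ℝ) ≤ R * (((freyCurve a b).conductorNorm ℤ : ℕ) : ℝ) ^ ε

/-! ## §1 NEW intermediate leaf: class radius from two odd good primes (no `ε`, no `N`) -/

/-- B0.  Any two curves in the isogeny class of the Frey curve `E_(a,b)` are joined by an isogeny of
degree `≤ 16·((p₀⁶+1)(p₁⁶+1))⁶` for ANY two distinct odd primes `p₀, p₁ ∤ ab(a+b)`. -/
def FreyClassRadiusTwoPrimes : Prop :=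
  ∀ (a b : ℤ), IsCoprime a b → a * b * (a + b) ≠ 0 →
    ∀ (W₁ W₂ : WeierstrassCurve ℚ) [W₁.IsElliptic] [W₂.IsElliptic],
      W₁.IsIsogenous (freyCurve a b) → W₂.IsIsogenous (freyCurve a b) →
      ∀ p₀ p₁ : ℕ, p₀.Prime → p₁.Prime → p₀ ≠ 2 → p₁ ≠ 2 → p₀ ≠ p₁ →
        ¬ (p₀ : ℤ) ∣ a * b * (a + b) → ¬ (p₁ : ℤ) ∣ a * b * (a + b) →
        ∃ φ : Isogeny W₁ W₂, φ.degree ≤ 16 * ((p₀ ^ 6 + 1) * (p₁ ^ 6 + 1)) ^ 6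

/-! ## §2 Helpers for B1 (transport) -/

/-- H7a (XS): the integer and the complex Newton sequences agree. -/
theorem intCast_frobTracePow (t q : ℤ) :
    ∀ n : ℕ, ((Mazur1978.frobTracePow t q n : ℤ) : ℂ) = frobTracePow (t : ℂ) (q : ℂ) n
  | 0 => by simp
  | 1 => by simp
  | n + 2 => by
    rw [Mazur1978.frobTracePow_add_two, frobTracePow, ← intCast_frobTracePow t q (n + 1),
      ← intCast_frobTracePow t q n]
    push_cast
    ring

/-- H7 (S): `(p⁶−1)² ≤ n₁₂(p) ≤ (p⁶+1)²` under Hasse `t² ≤ 4p` — from the landed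
`norm_frobTracePow_le_of_sq_le` (`|s₁₂| ≤ 2(√p)¹² = 2p⁶`) and H7a; in particular `0 < n₁₂(p)` for
`p ≥ 2`. -/
theorem frobNorm_bounds {t : ℤ} {p : ℕ} (hp : p.Prime) (ht : t ^ 2 ≤ 4 * (p : ℤ)) :
    0 < (p : ℤ) ^ 12 + 1 - Mazur1978.frobTracePow t p 12 ∧
      (p : ℤ) ^ 12 + 1 - Mazur1978.frobTracePow t p 12 ≤ ((p : ℤ) ^ 6 + 1) ^ 2 := by
  sorry

/-- H7′ (XS, corollary at a good prime of a globally minimal curve, Hasse = landed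
`frobeniusTrace_sq_le_four_mul`). -/
theorem frobNorm_pos_and_natAbs_le (W : WeierstrassCurve ℚ) [W.IsElliptic] [W.IsGloballyMinimal]
    (p : ℕ) [Fact p.Prime] (hgood : W.HasGoodReductionAtPrime p) :
    0 < frobNorm W p ∧ (frobNorm W p).natAbs ≤ (p ^ 6 + 1) ^ 2 := by
  sorry

/-- GR (XS): a curve isogenous to the Frey curve has good reduction at every odd `p ∤ ab(a+b)`
(`not_dvd_conductorNorm_freyCurve_of_not_dvd` + `hasGoodReductionAtPrime_of_not_dvd_conductorNorm`
+ `IsIsogenous.hasGoodReductionAtPrime_iff`). -/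
theorem hasGoodReductionAtPrime_of_isIsogenous_freyCurve {a b : ℤ} (hab : IsCoprime a b)
    (h0 : a * b * (a + b) ≠ 0) {W : WeierstrassCurve ℚ} [W.IsElliptic]
    (hW : W.IsIsogenous (freyCurve a b)) {p : ℕ} [Fact p.Prime] (hp2 : p ≠ 2)
    (hp : ¬ (p : ℤ) ∣ a * b * (a + b)) : W.HasGoodReductionAtPrime p := by
  sorry

/-- SEMI (S, = gen-5 ISO specialised): a curve isogenous to the Frey curve is semistable at every
place `v ∤ 2` (`hasMultiplicativeReductionAt_freyCurve_of_ne_two` /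
good reduction, transported by `hasMultiplicativeReductionAt_of_isIsogenous` /
`IsIsogenous.hasGoodReductionAtPrime_iff`). -/
theorem isSemistableAt_of_isIsogenous_freyCurve {a b : ℤ} (hab : IsCoprime a b)
    (h0 : a * b * (a + b) ≠ 0) {W : WeierstrassCurve ℚ} [W.IsElliptic]
    (hW : W.IsIsogenous (freyCurve a b)) (v : HeightOneSpectrum (𝓞 ℚ))
    (hv : (2 : 𝓞 ℚ) ∉ v.asIdeal) : W.IsSemistableAt v := by
  sorry

/-- R0a (XS, G4 verbatim, proved there): degree of a composite. -/
theorem degree_comp {W W' W'' : WeierstrassCurve ℚ} [W.IsElliptic] [W'.IsElliptic]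
    (ψ : Isogeny W' W'') (φ : Isogeny W W') : (ψ.comp φ).degree = ψ.degree * φ.degree := by
  change Nat.card (ψ.toAddMonoidHom.comp φ.toAddMonoidHom).ker = _
  rw [AddMonoidHom.natCard_ker_comp_of_surjective _ _ φ.surjective]
  rfl

/-- **B1 (S).** C0³ ⟹ B0: `W₁ ~ W₂` (`IsIsogenous.symm/trans`); Néron model `C • W₁` globally minimal
(`hasGlobalMinimalModel_rat_holds`) joined to `W₁` by the degree-`1` isogeny
`VariableChange.toIsogeny` (`degree_toIsogeny`); a CYCLIC isogeny `C • W₁ → W₂`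
(`IsIsogenous.exists_isCyclic`); SEMI, GR; C0³; H7′ makes the dividend a positive integer
`≤ 16·((p₀⁶+1)²(p₁⁶+1)²)³`, so `Nat.le_of_dvd`; compose (`degree_comp`). -/
theorem freyClassRadiusTwoPrimes_of_cube (h0 : CyclicDegreeDvdFrobNormCube) :
    FreyClassRadiusTwoPrimes := by
  sorry

/-! ## §3 Helpers for B2 (counting) -/

/-- H8 (S⁻): two distinct odd primes avoiding `m`, both `≤ 2·log m + O(1)`-ish — twice the landed
`exists_prime_not_dvd_le_log` (`PastenValuationProductThm75MultiplicityProofs`, Chebyshev `θ`):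
once with modulus `2m`, once with `2m·p₀`. -/
theorem exists_two_primes_not_dvd_le_log :
    ∃ C : ℝ, ∀ m : ℕ, m ≠ 0 →
      ∃ p₀ p₁ : ℕ, p₀.Prime ∧ p₁.Prime ∧ p₀ ≠ 2 ∧ p₁ ≠ 2 ∧ p₀ ≠ p₁ ∧ ¬ p₀ ∣ m ∧ ¬ p₁ ∣ m ∧
        (p₀ : ℝ) ≤ C * Real.log m + C ∧ (p₁ : ℝ) ≤ C * Real.log m + C := by
  sorry

/-- **B2 (S).** B0 ⟹ the `N^ε` class radius (in fact a POLYLOG radius `≪ (log N)⁷²`): H8 with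
`m := N` (conductor, `≠ 0` by `conductorNorm_pos_holds`); an odd prime `p ∤ N` has `p ∤ ab(a+b)`
(landed `radical_natAbs_dvd_two_mul_conductorNorm_freyCurve`: `rad|ab(a+b)| ∣ 2N`); then
`16((p₀⁶+1)(p₁⁶+1))⁶ ≤ 16·(C log N + C + 1)⁷² ≤ R(ε)·N^ε` by Mathlib `Real.log_le_rpow_div`
(`log N ≤ N^{ε/72}/(ε/72)`). -/
theorem freyClassRadiusSubpoly_of_twoPrimes (h : FreyClassRadiusTwoPrimes) :
    FreyClassRadiusSubpoly := by
  sorry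

/-! ## §4 The gen-6 counting end, composed (kernel-checked modulo the helper bodies) -/

/-- C0³ ⟹ `FreyClassRadiusSubpoly`.  With the G4 consumer (proved):
`definiteRTControlPrime_of_freyClassRadiusSubpoly stub_takahashi (freyClassRadiusSubpoly_of_cube C0³)
 : DefiniteRTControlPrime` — trust base `{Takahashi 2.3}` only, `C(ε) = 4·R(ε/2)²`. -/
theorem freyClassRadiusSubpoly_of_cube (h0 : CyclicDegreeDvdFrobNormCube) : FreyClassRadiusSubpoly :=
  freyClassRadiusSubpoly_of_twoPrimes (freyClassRadiusTwoPrimes_of_cube h0)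

/-! ## Sanity (quick refuters run in-kernel).
(1) `11a1` at `p = 3` (`a₃ = −1`, `s₁₂ = −1358`): `n₁₂(3) = 532800 ∈ [(3⁶−1)², (3⁶+1)²] = [529984, 532900]`.
(2) H7 recursion check: `s₁₂(−1, 3)` computed by `Mazur1978.frobTracePow`.
(3) the B0 bound at `(p₀,p₁) = (3,5)` is `16·(730·15626)⁶` — finite, dwarfing Kenku's `163`, but
uniform in the class: the `ε` is spent only in B2. -/
example : Mazur1978.frobTracePow (-1) 3 12 = -1358 := by decide
example : ((3 : ℤ) ^ 6 - 1) ^ 2 ≤ 3 ^ 12 + 1 - (-1358) ∧ (3 : ℤ) ^ 12 + 1 - (-1358) ≤ (3 ^ 6 + 1) ^ 2 := by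
  decide
example : ¬ (3 : ℤ) ∣ 1 * 1 * (1 + 1) ∧ ¬ (5 : ℤ) ∣ 1 * 1 * (1 + 1) := by decide
/-- `14a` (cyclic `18`-isogeny, odd part `9 = 3²`, `k = 2`, `m = 1`): `a₃ = −2`, `a₅ = 0`;
`9 ∣ n₁₂(3)` and `9 ∣ n₁₂(5)` (only `3 ∣` is claimed by H5 at `m = 1`). -/
example : Mazur1978.frobTracePow (-2) 3 12 = 658 ∧ (9 : ℤ) ∣ 3 ^ 12 + 1 - 658 := by decide
example : Mazur1978.frobTracePow 0 5 12 = 31250 ∧ (9 : ℤ) ∣ 5 ^ 12 + 1 - 31250 := by decide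

end Summit.ABC.ABC.Cruxes.DefiniteRTControlPrime.Sketch.Ideas2g6
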